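import Mathlib
import Literature.Computability.AlgebraicComplexity.GroupTheoreticMatMul

/-!
# Charts and the chart STPP theorem (Cohn–Kleinberg–Szegedy–Umans 2005, Def. 36 / Thm. 37)

Crux `stmt-MatrixMultiplication-10597` (route ThinBlockAlpha, refutation line
`refutation-null-chart-9`, stub `stub_chartSTPP`).

A *chart* assigns to every symbol `x : Γ` a triple of subsets `(A x, B x, C x)` of an additive
abelian group `H₀`.  A family of `L` rows `row : Fin L → Fin n → Γ` generates the product blocks
`A_i = ∏_c A (row i c)`, `B_i = ∏_c B (row i c)`, `C_i = ∏_c C (row i c)` in `H₀ⁿ = Fin n → H₀`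
(`Fintype.piFinset`).  We prove the chart version of CKSU Thm. 33 (= CKSU Thm. 37 in the tree's
conventions, over the tree's simultaneous triple product property `IsSTPP`,
`GroupTheoreticMatMul.lean`): if every symbol has the triple product property (`SymbolTPP`) and the
rows form a *local chart-USP* (`IsLocalChartUSP`: every ordered triple of rows with indices not all
equal has a coordinate whose symbol pattern is not solvable, `ChartSolvable`), then the generated
family of product blocks satisfies `IsSTPP`.

Proof (half a page, as for CKSU Thm. 33): the STPP relation `(s' - s) + (t' - t) + (u' - u) = 0`
in `H₀ⁿ` holds coordinate by coordinate; (1) if the indices `i, j, k` are not all equal, the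
local chart-USP coordinate `c` of `(i, j, k)` carries an unsolvable symbol pattern, but the `c`-th
coordinates of `s, s', t, t', u, u'` solve it — contradiction; (2) if `i = j = k`, the per-symbol
TPP at every coordinate gives `s c = s' c`, `t c = t' c`, `u c = u' c`, hence `s = s'`, `t = t'`,
`u = u'` by function extensionality.

Source: H. Cohn, R. Kleinberg, B. Szegedy, C. Umans, *Group-theoretic algorithms for matrix
multiplication*, FOCS 2005, arXiv:math/0511460, §6 (Def. 36, Thm. 37).
-/

-- `Summit.<Summit>.<Problem>` is the tree's mandated summit-side namespace; for this
-- single-conjunct summit the two coincide, so the file silences `dupNamespace`.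
set_option linter.dupNamespace false

namespace Summit.MatrixMultiplication.MatrixMultiplication.Theorems

open Literature.Computability.AlgebraicComplexity

/-- Solvability of the one-coordinate STPP relation for the symbol pattern `(x, y, z)` = (symbols of
rows `i, j, k`): some `s ∈ A z, s' ∈ A x, t ∈ B x, t' ∈ B y, u ∈ C y, u' ∈ C z` with
`(s' - s) + (t' - t) + (u' - u) = 0` (the index pattern of the tree's `IsSTPP`). [folklore] -/
def ChartSolvable {H₀ Γ : Type} [AddCommGroup H₀] (A B C : Γ → Finset H₀) (x y z : Γ) : Prop :=
  ∃ s ∈ A z, ∃ s' ∈ A x, ∃ t ∈ B x, ∃ t' ∈ B y, ∃ u ∈ C y, ∃ u' ∈ C z,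
    (s' - s) + (t' - t) + (u' - u) = 0

/-- The triple product property of one symbol `(A, B, C)` in the STPP form (Cohn–Umans 2003,
Def. 2.1, additive). [cite: CohnUmans2003, Def. 2.1] -/
def SymbolTPP {H₀ : Type} [AddCommGroup H₀] (A B C : Finset H₀) : Prop :=
  ∀ s ∈ A, ∀ s' ∈ A, ∀ t ∈ B, ∀ t' ∈ B, ∀ u ∈ C, ∀ u' ∈ C,
    (s' - s) + (t' - t) + (u' - u) = 0 → s = s' ∧ t = t' ∧ u = u'

/-- **Local chart-USP** (Cohn–Kleinberg–Szegedy–Umans 2005, Def. 36, local form): every ordered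
triple of rows with indices not all equal has a coordinate whose symbol pattern is not solvable.
[cite: CohnKleinbergSzegedyUmans2005, Def. 36] -/
def IsLocalChartUSP {H₀ Γ : Type} [AddCommGroup H₀] (A B C : Γ → Finset H₀) {n L : ℕ}
    (row : Fin L → Fin n → Γ) : Prop :=
  ∀ i j k : Fin L, (i ≠ j ∨ j ≠ k) → ∃ c : Fin n, ¬ ChartSolvable A B C (row i c) (row j c) (row k c)

/-- **Cohn–Kleinberg–Szegedy–Umans 2005, Theorem 37** in the tree's conventions: a local chart-USP
over a chart with per-symbol TPP generates an STPP family of product sets in `H₀ⁿ`.  Precisely: for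
a chart `(A, B, C) : Γ → (Finset H₀)³` all of whose symbols have the triple product property
(`SymbolTPP`) and a local chart-USP `row : Fin L → Fin n → Γ` (`IsLocalChartUSP`), the family of
product blocks `(∏_c A (row i c), ∏_c B (row i c), ∏_c C (row i c))_{i < L}` in `Fin n → H₀`
satisfies the simultaneous triple product property `IsSTPP`.
[cite: CohnKleinbergSzegedyUmans2005, Thm. 37] -/
theorem stub_chartSTPP : ∀ (H₀ Γ : Type) [AddCommGroup H₀] [DecidableEq H₀]
    (A B C : Γ → Finset H₀), (∀ x, SymbolTPP (A x) (B x) (C x)) →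
    ∀ (n L : ℕ) (row : Fin L → Fin n → Γ), IsLocalChartUSP A B C row →
      IsSTPP (fun i => Fintype.piFinset fun c => A (row i c))
        (fun i => Fintype.piFinset fun c => B (row i c))
        (fun i => Fintype.piFinset fun c => C (row i c)) := by
  intro H₀ Γ _ _ A B C hTPP n L row hU i j k s hs s' hs' t ht t' ht' u hu u' hu' hsum
  simp only [Fintype.mem_piFinset] at hs hs' ht ht' hu hu'
  -- the relation, coordinate by coordinate
  have hc : ∀ c : Fin n, s' c - s c + (t' c - t c) + (u' c - u c) = 0 := fun c => by
    have e := congrFun hsum c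
    simpa only [Pi.add_apply, Pi.sub_apply, Pi.zero_apply] using e
  -- (1) simultaneity: the indices are all equal
  have hijk : i = j ∧ j = k := by
    by_contra hne
    have hne' : i ≠ j ∨ j ≠ k := by
      rcases eq_or_ne i j with hij | hij
      · exact Or.inr fun hjk => hne ⟨hij, hjk⟩
      · exact Or.inl hij
    -- the local chart-USP coordinate of the ordered triple `(i, j, k)`
    obtain ⟨c, hpat⟩ := hU i j k hne'
    exact hpat ⟨s c, hs c, s' c, hs' c, t c, ht c, t' c, ht' c, u c, hu c, u' c, hu' c, hc c⟩
  -- (2) the triple product property of each symbol, coordinate by coordinate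
  obtain ⟨hij, hjk⟩ := hijk
  subst hjk
  subst hij
  have key : ∀ c : Fin n, s c = s' c ∧ t c = t' c ∧ u c = u' c := fun c =>
    hTPP (row i c) (s c) (hs c) (s' c) (hs' c) (t c) (ht c) (t' c) (ht' c) (u c) (hu c) (u' c)
      (hu' c) (hc c)
  exact ⟨rfl, rfl, funext fun c => (key c).1, funext fun c => (key c).2.1,
    funext fun c => (key c).2.2⟩

end Summit.MatrixMultiplication.MatrixMultiplication.Theorems
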